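/-
Copyright (c) 2026 the pub-hodgecm-mathlib formalisation cell (harness21).  Prover seat hodgecm-mathlib-LH4-p08 (g9), req620 Track A «(D-RAM) FOUR-FRAME» squad, helper lane
on h413 = stmt-HodgeConjecture-24833 (count-neutral).  Dealer∕pen LH4-plan (g13) WORD #118: (β-TABLE) (T3) «THE FINITE IDENTITY `oddLabelledBoxSum`» — ENGINE, part 1.  2026-09-04.
-/
import Mathlib.Algebra.BigOperators.Intervals
import Mathlib.Algebra.Order.BigOperators.Group.Finset
import Mathlib.Tactic
import HarnessLib

/-!
# Crux `H413`, line LH4 «(D-RAM) FOUR-FRAME» — (β) road, (T3) ENGINE part 1: the BRACKETED TELESCOPE and the SUPPORT LEMMAS of the odd table's planes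

Cell `hodgecm-mathlib` (D-0151), FLOOR 0, crux item H413 = `stmt-HodgeConjecture-24833`, route of record `HCCMUnconditional`; squad F0∕P3c∕LH4; helper lane
`--supports stmt-HodgeConjecture-24833 --as helper` (count-neutral).  THEOREMS ONLY (no `def`, no instance, no notation, no `sorry`; default heartbeats); PURE ALGEBRA
(any commutative ring ∕ additive commutative monoid): no field, no place, no lattice.

The (β) table identity (T1) `OddLabelledBoxSum` (F0P3a-p01 (g37), under LH4-p05 (g8)'s B2b-3 architecture) says that the labelled-odd box sum of the clean-shell Stage-B table
vanishes.  Its proof (T3, this seat) reduces the box to the diagonal and three planes (★ `F0P3cDyRamStableCountBoxReindex`), and each plane to its READ LINE `t = n_X − ℓ₀` plus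
the special tower's κ-ROW `r = m − ℓ₀`; along the read line each non-own slot is a finite geometric telescope in the glue depth `ρ`.  This file is that arithmetic:
* `sum_pow_mul_bracket`, `tower_slot_total` — `Σ_{ρ=1}^{M} x^{ρ−1}·F(n, ρ)` with the table's boundary factor `F(n, ρ) = (x − 1)·[2d + ℓ + 2ρ ≤ n] − [n + 2 = 2d + ℓ + 2ρ]`
  telescopes to `x^{min M P} − 1 − [P + 1 ≤ M]·x^P` (`2P + 2d + ℓ = n`); with the tower term, `c·x^S·(1 + Σ) = [¬(P + 1 ≤ M)]·c·x^{S+M}`: ZERO when the «flip class»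
  `ρ = P + 1` exists, else the SURPLUS;
* `triangle_sum_eq_line_add_row` — a triangular sum `Σ_{r<t≤B} φ r t` supported on one line `t = N` and one row `r = M` is the line sum plus the row sum;
* `sum_range_eq_zero_add_sum_even` — re-indexing of a range sum vanishing at odd arguments and beyond an even cut-off `K` by `r = 2ρ`, `1 ≤ ρ ≤ K∕2`.
Part 2 (`…OddLabelledBoxSumPlanes`) evaluates the three plane types (OWN ∕ PLAIN ∕ TWISTED slot) with these; the assembly `…OddLabelledBoxSum` closes (T1).
HONEST LABEL.  Count-neutral pure arithmetic; states nothing about any place or lattice; (T1) is a draft letter, (β)∕table∕T₊ OPEN; `HC_CM` is proved only modulo the 7 printed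
citations (2 remaining named inputs: hLiu418 = `stmt-HodgeConjecture-24832`, h413 = `stmt-HodgeConjecture-24833`) until rung 0 closes.

## References
* [Kottwitz1986BaseChangeUnits] R. E. Kottwitz, *Base change for unit elements of Hecke algebras*, Compositio Math. 60 (1986), §1 pp. 240–241 (signed lattice counts by torus orbits — the sums being re-indexed).
* [Rogawski1990] J. D. Rogawski, *Automorphic Representations of Unitary Groups in Three Variables*, Ann. of Math. Stud. 123 (1990), §4.9 Prop. 4.9.1 (a)(b) p. 55 (the geometric-series shape of the orbit counts).
-/

set_option autoImplicit false

open Finset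

namespace Summit.HodgeConjecture.HodgeConjecture.Cruxes.H413.F0P3cDyRamOddLabelledBoxSumArith

section Telescope

variable {R : Type*} [CommRing R]

/-- **The bracketed telescope** in the (T1) letter's shape `F(n, ρ) = (x − 1)·[2d + ℓ + 2ρ ≤ n] − [n + 2 = 2d + ℓ + 2ρ]`:
`Σ_{ρ=1}^{M} x^{ρ−1}·F(n, ρ) = x^{min M P} − 1 − [P + 1 ≤ M]·x^P` where `2P + 2d + ℓ = n`. [folklore] -/
theorem sum_pow_mul_bracket (x : R) {d l n M P : ℕ} (hP : 2 * P + 2 * d + l = n) :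
    ∑ ρ ∈ Icc 1 M, x ^ (ρ - 1) * ((if 2 * d + l + 2 * ρ ≤ n then x - 1 else 0) - (if n + 2 = 2 * d + l + 2 * ρ then (1 : R) else 0)) =
      x ^ (min M P) - 1 - (if P + 1 ≤ M then x ^ P else 0) := by
  induction M with
  | zero => simp
  | succ M ih =>
    rw [Finset.sum_Icc_succ_top (by omega), ih, Nat.add_sub_cancel]
    by_cases hM : M + 1 ≤ P
    · have c1 : 2 * d + l + 2 * (M + 1) ≤ n := by omega
      have c2 : ¬ (n + 2 = 2 * d + l + 2 * (M + 1)) := by omega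
      have c3 : ¬ (P + 1 ≤ M) := by omega
      have c4 : ¬ (P + 1 ≤ M + 1) := by omega
      rw [if_pos c1, if_neg c2, if_neg c3, if_neg c4, min_eq_left (by omega : M ≤ P), min_eq_left hM, pow_succ]
      ring
    · by_cases hM' : M = P
      · subst hM'
        have c1 : ¬ (2 * d + l + 2 * (M + 1) ≤ n) := by omega
        have c2 : n + 2 = 2 * d + l + 2 * (M + 1) := by omega
        have c3 : ¬ (M + 1 ≤ M) := by omega
        have c4 : M + 1 ≤ M + 1 := le_rfl
        rw [if_neg c1, if_pos c2, if_neg c3, if_pos c4, min_self, min_eq_right (by omega : M ≤ M + 1)]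
        ring
      · have c1 : ¬ (2 * d + l + 2 * (M + 1) ≤ n) := by omega
        have c2 : ¬ (n + 2 = 2 * d + l + 2 * (M + 1)) := by omega
        have c3 : P + 1 ≤ M := by omega
        have c4 : P + 1 ≤ M + 1 := by omega
        rw [if_neg c1, if_neg c2, if_pos c3, if_pos c4, min_eq_right (by omega : P ≤ M), min_eq_right (by omega : P ≤ M + 1)]
        ring

/-- **One tower, one non-own slot — the TOTAL of the read line**: `c·x^S·(1 + Σ_{ρ=1}^{M} x^{ρ−1}F(n,ρ)) = [¬(P+1 ≤ M)]·c·x^{S+M}`. [folklore] -/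
theorem tower_slot_total (x c : R) {d l n M P : ℕ} (S : ℕ) (hP : 2 * P + 2 * d + l = n) :
    c * x ^ S + ∑ ρ ∈ Icc 1 M, c * x ^ (S + ρ - 1) * ((if 2 * d + l + 2 * ρ ≤ n then x - 1 else 0) - (if n + 2 = 2 * d + l + 2 * ρ then (1 : R) else 0)) =
      if P + 1 ≤ M then 0 else c * x ^ (S + M) := by
  have hre : ∀ ρ ∈ Icc 1 M, c * x ^ (S + ρ - 1) * ((if 2 * d + l + 2 * ρ ≤ n then x - 1 else 0) - (if n + 2 = 2 * d + l + 2 * ρ then (1 : R) else 0)) =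
      c * x ^ S * (x ^ (ρ - 1) * ((if 2 * d + l + 2 * ρ ≤ n then x - 1 else 0) - (if n + 2 = 2 * d + l + 2 * ρ then (1 : R) else 0))) := by
    intro ρ hρ
    simp only [Finset.mem_Icc] at hρ
    rw [show S + ρ - 1 = S + (ρ - 1) by omega, pow_add]; ring
  rw [Finset.sum_congr rfl hre, ← Finset.mul_sum, sum_pow_mul_bracket x hP]
  by_cases h : P + 1 ≤ M
  · rw [if_pos h, if_pos h, min_eq_right (by omega : P ≤ M)]; ring
  · rw [if_neg h, if_neg h, min_eq_left (by omega : M ≤ P), pow_add]; ring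

end Telescope

section Support

variable {R : Type*} [AddCommMonoid R]

/-- **Support lemma for one plane**: a triangular sum supported on the READ LINE `t = N` and the κ-ROW `r = M` is the line sum plus the row sum (the cell `(M, N)` on the line). [folklore] -/
theorem triangle_sum_eq_line_add_row (φ : ℕ → ℕ → R) {N M B : ℕ} (hN : N ≤ B) (hM : M ≤ B)
    (h0 : ∀ r t, r < t → t ≤ B → t ≠ N → r ≠ M → φ r t = 0) :
    ∑ r ∈ range (B + 1), ∑ t ∈ range (B + 1), (if r < t then φ r t else 0) =
      ∑ r ∈ range N, φ r N + ∑ t ∈ range (B + 1), (if M < t ∧ t ≠ N then φ M t else 0) := by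
  classical
  have hsplit : ∀ r ∈ range (B + 1), ∀ t ∈ range (B + 1), (if r < t then φ r t else 0) =
      (if r < t ∧ t = N then φ r t else 0) + (if r < t ∧ t ≠ N ∧ r = M then φ r t else 0) := by
    intro r hr t ht
    simp only [Finset.mem_range] at hr ht
    by_cases hrt : r < t
    · by_cases htN : t = N
      · rw [if_pos hrt, if_pos ⟨hrt, htN⟩, if_neg (fun h => h.2.1 htN), add_zero]
      · by_cases hrM : r = M
        · rw [if_pos hrt, if_neg (fun h => htN h.2), if_pos ⟨hrt, htN, hrM⟩, zero_add]
        · rw [if_pos hrt, if_neg (fun h => htN h.2), if_neg (fun h => hrM h.2.2), add_zero, h0 r t hrt (by omega) htN hrM]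
    · rw [if_neg hrt, if_neg (fun h => hrt h.1), if_neg (fun h => hrt h.1), add_zero]
  rw [Finset.sum_congr rfl fun r hr => Finset.sum_congr rfl fun t ht => hsplit r hr t ht]
  simp only [Finset.sum_add_distrib]
  congr 1
  · have hNmem : N ∈ range (B + 1) := by simp; omega
    rw [Finset.sum_congr rfl fun r _ => Finset.sum_eq_single_of_mem N hNmem (fun t _ htN => if_neg (fun h => htN h.2))]
    simp only [and_true]
    rw [← Finset.sum_filter]
    refine Finset.sum_congr ?_ fun _ _ => rfl
    ext r
    simp only [Finset.mem_filter, Finset.mem_range]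
    omega
  · rw [Finset.sum_comm]
    have hMmem : M ∈ range (B + 1) := by simp; omega
    refine Finset.sum_congr rfl fun t _ => ?_
    rw [Finset.sum_eq_single_of_mem M hMmem (fun r _ hrM => if_neg (fun h => hrM h.2.2))]
    by_cases h : M < t ∧ t ≠ N
    · rw [if_pos h, if_pos ⟨h.1, h.2, rfl⟩]
    · rw [if_neg h, if_neg (fun h' => h ⟨h'.1, h'.2.1⟩)]

/-- **Even re-indexing of a range sum**: if `g` vanishes at the odd arguments below `N` and beyond `K` (`K` even, `K < N`), then
`Σ_{r<N} g r = g 0 + Σ_{ρ=1}^{K∕2} g (2ρ)`. [folklore] -/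
theorem sum_range_eq_zero_add_sum_even (g : ℕ → R) {N K : ℕ} (hK : K < N) (hK2 : 2 ∣ K)
    (hodd : ∀ r, r < N → ¬ 2 ∣ r → g r = 0) (hbig : ∀ r, K < r → r < N → g r = 0) :
    ∑ r ∈ range N, g r = g 0 + ∑ ρ ∈ Icc 1 (K / 2), g (2 * ρ) := by
  classical
  obtain ⟨k, rfl⟩ := hK2
  rw [Nat.mul_div_cancel_left k (by norm_num)]
  -- keep only the even arguments `≤ 2k`
  have hsub : ∑ r ∈ range N, g r = ∑ r ∈ (range N).filter (fun r => 2 ∣ r ∧ r ≤ 2 * k), g r := by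
    rw [Finset.sum_filter]
    refine Finset.sum_congr rfl fun r hr => ?_
    simp only [Finset.mem_range] at hr
    by_cases h : 2 ∣ r ∧ r ≤ 2 * k
    · rw [if_pos h]
    · rw [if_neg h]
      by_cases h2 : 2 ∣ r
      · exact hbig r (by omega) hr
      · exact hodd r hr h2
  have hset : (range N).filter (fun r => 2 ∣ r ∧ r ≤ 2 * k) = (range (k + 1)).image (fun ρ => 2 * ρ) := by
    ext r
    simp only [Finset.mem_filter, Finset.mem_range, Finset.mem_image]
    constructor
    · rintro ⟨hr, ⟨ρ, rfl⟩, hle⟩; exact ⟨ρ, by omega, rfl⟩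
    · rintro ⟨ρ, hρ, rfl⟩; exact ⟨by omega, ⟨ρ, rfl⟩, by omega⟩
  have hinj : Set.InjOn (fun ρ : ℕ => 2 * ρ) ↑(range (k + 1)) := fun a _ b _ h => by simpa using h
  rw [hsub, hset, Finset.sum_image hinj, Finset.range_eq_Ico, Finset.sum_eq_sum_Ico_succ_bot (by omega), mul_zero]
  congr 1

end Support

end Summit.HodgeConjecture.HodgeConjecture.Cruxes.H413.F0P3cDyRamOddLabelledBoxSumArith
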